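import Summits.BirchSwinnertonDyer.BirchSwinnertonDyer.Theorems.ThetaPartnerAtTwoMazurTateCongruenceAtTwoROfSymbolLaw
import Literature.NumberTheory.EllipticCurves.PAdicLFunctionDistributionHoldsProofs
import HarnessLib

/-!
# Crux `MazurTateCongruenceAtTwoTop` (stmt-BirchSwinnertonDyer-25797 = 21416 by name), line `symbol`: LAYER DESCENT —
# the depleted-symbol law at level `2^{n+4}` implies it at level `2^{n+2}` (Hecke relation at `2` with `a₂ = 0`), so the
# registered stub (SP2) follows from its EVENTUAL form «for all large even `n`» (lead prover bsd-wall-tp2-p1 g10; `--supports 25797`)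

HONEST FRAMING. THEOREMS ONLY; nothing about the truth of (SP2) is asserted; BSD is not proved by any of this.

WHAT. For the newform `f` of a curve good at `2` with `a₂ = 0`, the Hecke relation `a₂[y]⁺ = [y/2]⁺ + [(y+1)/2]⁺ + [2y]⁺`
(`intCast_mul_ratPlusSymbol`, with `ratCast_ratPlusSymbol_holds`) reads `[y]⁺ = −[y/4]⁺ − [y/4 + ½]⁺`; the relation survives
depletion at odd places (`1`-periodicity: `ℓ^i/2 ≡ ½ (mod ℤ)`), so every depleted table `Φ^l = eulerDepleteTableList W l [·]⁺_f`
satisfies `Φ^l(a/2^k) = −Φ^l(a/2^{k+2}) − Φ^l((a + 2^{k+1})/2^{k+2})`, both numerators on the right being odd when `a` is.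
Hence (ultrametric inequality) the (SP2)-quantity at level `2^{n+2}` is bounded by the maximum of two (SP2)-quantities at level
`2^{n+4}`: **the law descends two layers at a time**, and (SP2) ⟸ (SP2-ev) «∃ u, ∃ n₀, ∀ even n ≥ n₀, ∀ odd a, …»
(`depletedSymbolLaw_of_eventually`) — the currency («for all large even `n`») of the route ResidualThetaTransportAtTwo's
analytic crux `ThetaLayerLambdaCongruenceAtTwo` and of its landed multiplicity-one glue. Consequently the crux follows from
(SP2-ev) (`mazurTateCongruenceAtTwoTop_of_eventuallyDepletedSymbolLaw`).

References: [MazurTateTeitelbaum1986Invent] §I.4 (4.2), §I.8, §I.10; [GreenbergVatsal2000] §3 (13); [PollackWeston2011MT] §3.1.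
-/

set_option linter.dupNamespace false
set_option autoImplicit false

noncomputable section

open scoped Classical MatrixGroups ModularForm

open CongruenceSubgroup Polynomial WeierstrassCurve NumberField IsDedekindDomain
  Literature.NumberTheory.EllipticCurves Literature.NumberTheory.EllipticCurves.ModularForms
  Literature.NumberTheory.EllipticCurves.Rank1Residual Literature.NumberTheory.EllipticCurves.GreenbergVatsal2000
  Summit.BirchSwinnertonDyer.BirchSwinnertonDyer.Theorems.ThetaLayerLambdaCongruenceAtTwo

namespace Summit.BirchSwinnertonDyer.BirchSwinnertonDyer.Theorems.MazurTateCongruenceAtTwoR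

/-! ## §1. The Hecke relation at `2` with `a₂ = 0`, for the plus symbols and for the depleted tables -/

section Hecke

/-- **`[y]⁺ = −[y/4]⁺ − [y/4 + ½]⁺`** for the newform of a curve with good reduction at `2` and `a₂ = 0`: the Hecke
relation `a₂[y/2]⁺ = [y/4]⁺ + [(y/2+1)/2]⁺ + [y]⁺` with `a₂ = 0`. [cite: MazurTateTeitelbaum1986Invent, §I.4 (4.2) and §I.8] -/
theorem ratPlusSymbol_eq_neg_of_frobeniusTrace_two_eq_zero (W : WeierstrassCurve ℚ) [W.IsElliptic] [W.IsGloballyMinimal]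
    (hgood : W.HasGoodReductionAtPrime 2) (ha : W.frobeniusTrace 2 = 0) {N : ℕ} [NeZero N] {f : CuspForm (Gamma0 N) 2}
    (hf : IsNewformOf W f) (y : ℚ) :
    ratPlusSymbol f y = -ratPlusSymbol f (y / 4) - ratPlusSymbol f (y / 4 + 1 / 2) := by
  haveI : Fact (Nat.Prime 2) := ⟨Nat.prime_two⟩
  have hap : cuspCoeff f 2 = ((0 : ℤ) : ℂ) := by
    rw [cuspCoeff_eq_frobeniusTrace_of_isNewformOf_holds hf hgood, ha]
  have h := intCast_mul_ratPlusSymbol 2 hf.1 Nat.prime_two (not_dvd_level_of_isNewformOf hf hgood) hap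
    (ratCast_ratPlusSymbol_holds hf.1 hf.coeffField_eq_bot) (y / 2)
  rw [Fin.sum_univ_two] at h
  simp only [Int.cast_zero, zero_mul, Fin.val_zero, Nat.cast_zero, add_zero, Fin.val_one, Nat.cast_one,
    Nat.cast_ofNat] at h
  have e1 : y / 2 / 2 = y / 4 := by ring
  have e2 : (y / 2 + 1) / 2 = y / 4 + 1 / 2 := by ring
  have e3 : (2 : ℚ) * (y / 2) = y := by ring
  rw [e1, e2, e3] at h
  linarith

/-- The relation `φ(y) = −φ(y/4) − φ(y/4 + ½)` survives the one-place depletion at an odd place (for a `1`-periodic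
table). [cite: EmertonPollackWeston2006, §3 (3.4)–(3.5)] -/
theorem eulerDepleteTable_heckeTwo (W : WeierstrassCurve ℚ) (v : HeightOneSpectrum (𝓞 ℚ))
    (hv : ¬ 2 ∣ Rat.HeightOneSpectrum.natGenerator v) {φ : ℚ → ℚ} (hper : ∀ (x : ℚ) (z : ℤ), φ (x + z) = φ x)
    (hφ : ∀ y, φ y = -φ (y / 4) - φ (y / 4 + 1 / 2)) (y : ℚ) :
    eulerDepleteTable W v φ y = -eulerDepleteTable W v φ (y / 4) - eulerDepleteTable W v φ (y / 4 + 1 / 2) := by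
  simp only [eulerDepleteTable, ← Finset.sum_neg_distrib, ← Finset.sum_sub_distrib]
  refine Finset.sum_congr rfl fun i _ ↦ ?_
  set ℓ : ℕ := Rat.HeightOneSpectrum.natGenerator v with hℓ
  -- `ℓ^i` is odd: `ℓ^i (y/4 + 1/2) = ℓ^i y/4 + 1/2 + (ℓ^i - 1)/2`
  have hodd : ¬ 2 ∣ ℓ ^ i := fun h ↦ hv (Nat.prime_two.dvd_of_dvd_pow h)
  obtain ⟨k, hk⟩ : Odd (ℓ ^ i) := Nat.odd_iff.mpr (Nat.two_dvd_ne_zero.mp hodd)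
  have e : (ℓ : ℚ) ^ i * (y / 4 + 1 / 2) = (ℓ : ℚ) ^ i * y / 4 + 1 / 2 + ((k : ℤ) : ℚ) := by
    have : ((ℓ : ℚ) ^ i) = 2 * (k : ℚ) + 1 := by exact_mod_cast hk
    rw [this]; push_cast; ring
  rw [hφ ((ℓ : ℚ) ^ i * y), e, hper, mul_div_assoc]
  ring

/-- The depleted table over a list of odd places inherits `Φ(y) = −Φ(y/4) − Φ(y/4 + ½)`.
[cite: EmertonPollackWeston2006, §3 (3.4)–(3.5)] -/
theorem eulerDepleteTableList_heckeTwo (W : WeierstrassCurve ℚ) (l : List (HeightOneSpectrum (𝓞 ℚ)))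
    (hl : ∀ v ∈ l, ¬ 2 ∣ Rat.HeightOneSpectrum.natGenerator v) {φ : ℚ → ℚ} (hper : ∀ (x : ℚ) (z : ℤ), φ (x + z) = φ x)
    (hφ : ∀ y, φ y = -φ (y / 4) - φ (y / 4 + 1 / 2)) :
    ∀ y, eulerDepleteTableList W l φ y =
      -eulerDepleteTableList W l φ (y / 4) - eulerDepleteTableList W l φ (y / 4 + 1 / 2) := by
  induction l with
  | nil => exact hφ
  | cons v l ih =>
    intro y
    show eulerDepleteTable W v (eulerDepleteTableList W l φ) y = _
    exact eulerDepleteTable_heckeTwo W v (hl v List.mem_cons_self) (eulerDepleteTableList_add_intCast' W l hper)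
      (ih fun w hw ↦ hl w (List.mem_cons_of_mem _ hw)) y

/-- **Two-layer descent of the depleted Néron table**: for `W` good supersingular at `2` with `a₂ = 0`, newform `f`, a list
`l` of odd places and any `a, k`: `Φ^l(a/2^k) = −Φ^l(a/2^{k+2}) − Φ^l((a + 2^{k+1})/2^{k+2})`.
[cite: MazurTateTeitelbaum1986Invent, §I.4 (4.2) and §I.10] -/
theorem eulerDepleteTableList_descent (W : WeierstrassCurve ℚ) [W.IsElliptic] [W.IsGloballyMinimal] (hss : GoodSS W 2)
    (ha : W.frobeniusTrace 2 = 0) {N : ℕ} [NeZero N] {f : CuspForm (Gamma0 N) 2} (hf : IsNewformOf W f)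
    (l : List (HeightOneSpectrum (𝓞 ℚ))) (hl : ∀ v ∈ l, ((2 : ℕ) : 𝓞 ℚ) ∉ v.asIdeal) (a k : ℕ) :
    eulerDepleteTableList W l (ratPlusSymbol f) ((a : ℚ) / (2 : ℚ) ^ k) =
      -eulerDepleteTableList W l (ratPlusSymbol f) ((a : ℚ) / (2 : ℚ) ^ (k + 2)) -
        eulerDepleteTableList W l (ratPlusSymbol f) (((a + 2 ^ (k + 1) : ℕ) : ℚ) / (2 : ℚ) ^ (k + 2)) := by
  have h := eulerDepleteTableList_heckeTwo W l (fun v hv ↦ not_two_dvd_natGenerator (hl v hv))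
    (ratPlusSymbol_add_intCast_eq f) (ratPlusSymbol_eq_neg_of_frobeniusTrace_two_eq_zero W hss.1 ha hf)
    ((a : ℚ) / (2 : ℚ) ^ k)
  have e1 : (a : ℚ) / (2 : ℚ) ^ k / 4 = (a : ℚ) / (2 : ℚ) ^ (k + 2) := by rw [pow_add]; ring
  have e2 : (a : ℚ) / (2 : ℚ) ^ k / 4 + 1 / 2 = ((a + 2 ^ (k + 1) : ℕ) : ℚ) / (2 : ℚ) ^ (k + 2) := by
    push_cast
    rw [pow_add, pow_succ]
    field_simp
    ring
  rw [h, e2, e1]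

end Hecke

/-! ## §2. (SP2) from its eventual form -/

section Descent

/-- **(SP2-ev) ⟹ (SP2): the depleted-symbol law descends from large even layers to all even layers.**
[cite: MazurTateTeitelbaum1986Invent, §I.4 (4.2) and §I.10] [cite: GreenbergVatsal2000, §3 (13)] -/
theorem depletedSymbolLaw_of_eventually
    (hEv : ∀ (W : WeierstrassCurve ℚ) [W.IsElliptic] [W.IsGloballyMinimal] (A : WeierstrassCurve ℚ) [A.IsElliptic]
      [A.IsGloballyMinimal], ¬ W.HasCM → W.analyticRank = 0 → GoodSS W 2 → W.frobeniusTrace 2 = 0 → A.HasCM →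
      GoodSS A 2 → A.frobeniusTrace 2 = 0 →
      (∃ e : WeierstrassCurve.geomTorsion W (2 : ℤ) ≃+ WeierstrassCurve.geomTorsion A (2 : ℤ),
        ∀ (σ : Field.absoluteGaloisGroup ℚ) (P : WeierstrassCurve.geomTorsion W (2 : ℤ)), e (σ • P) = σ • e P) →
      ∀ [NeZero (W.conductorNorm ℤ)] (f : CuspForm (Gamma0 (W.conductorNorm ℤ)) 2), IsNewformOf W f →
      ∀ (ϖ : ℚ), (ϖ : ℝ) * W.realPeriodRat = plusPeriod f →
      ∀ [NeZero (A.conductorNorm ℤ)] (fA : CuspForm (Gamma0 (A.conductorNorm ℤ)) 2), IsNewformOf A fA →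
      ∀ (ϖA : ℚ), (ϖA : ℝ) * A.realPeriodRat = plusPeriod fA →
      ∀ (l : List (HeightOneSpectrum (𝓞 ℚ))), l.Nodup → (∀ v ∈ l, ((2 : ℕ) : 𝓞 ℚ) ∉ v.asIdeal) →
        (∀ v : HeightOneSpectrum (𝓞 ℚ), ¬ W.HasGoodReductionAt v → v ∈ l) →
        (∀ v : HeightOneSpectrum (𝓞 ℚ), ¬ A.HasGoodReductionAt v → v ∈ l) →
      ∃ (u : ℤ_[2]ˣ) (n₀ : ℕ), ∀ n : ℕ, n₀ ≤ n → Even n → ∀ a : ℕ, Odd a →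
        ‖((ϖ * eulerDepleteTableList W l (ratPlusSymbol f) ((a : ℚ) / (2 : ℚ) ^ (n + 2)) : ℚ) : ℚ_[2]) -
            ((u : ℤ_[2]) : ℚ_[2]) *
              ((ϖA * eulerDepleteTableList A l (ratPlusSymbol fA) ((a : ℚ) / (2 : ℚ) ^ (n + 2)) : ℚ) : ℚ_[2])‖ ≤ 1) :
    ∀ (W : WeierstrassCurve ℚ) [W.IsElliptic] [W.IsGloballyMinimal] (A : WeierstrassCurve ℚ) [A.IsElliptic]
      [A.IsGloballyMinimal], ¬ W.HasCM → W.analyticRank = 0 → GoodSS W 2 → W.frobeniusTrace 2 = 0 → A.HasCM →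
      GoodSS A 2 → A.frobeniusTrace 2 = 0 →
      (∃ e : WeierstrassCurve.geomTorsion W (2 : ℤ) ≃+ WeierstrassCurve.geomTorsion A (2 : ℤ),
        ∀ (σ : Field.absoluteGaloisGroup ℚ) (P : WeierstrassCurve.geomTorsion W (2 : ℤ)), e (σ • P) = σ • e P) →
      ∀ [NeZero (W.conductorNorm ℤ)] (f : CuspForm (Gamma0 (W.conductorNorm ℤ)) 2), IsNewformOf W f →
      ∀ (ϖ : ℚ), (ϖ : ℝ) * W.realPeriodRat = plusPeriod f →
      ∀ [NeZero (A.conductorNorm ℤ)] (fA : CuspForm (Gamma0 (A.conductorNorm ℤ)) 2), IsNewformOf A fA →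
      ∀ (ϖA : ℚ), (ϖA : ℝ) * A.realPeriodRat = plusPeriod fA →
      ∀ (l : List (HeightOneSpectrum (𝓞 ℚ))), l.Nodup → (∀ v ∈ l, ((2 : ℕ) : 𝓞 ℚ) ∉ v.asIdeal) →
        (∀ v : HeightOneSpectrum (𝓞 ℚ), ¬ W.HasGoodReductionAt v → v ∈ l) →
        (∀ v : HeightOneSpectrum (𝓞 ℚ), ¬ A.HasGoodReductionAt v → v ∈ l) →
      ∃ u : ℤ_[2]ˣ, ∀ n : ℕ, Even n → ∀ a : ℕ, Odd a →
        ‖((ϖ * eulerDepleteTableList W l (ratPlusSymbol f) ((a : ℚ) / (2 : ℚ) ^ (n + 2)) : ℚ) : ℚ_[2]) -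
            ((u : ℤ_[2]) : ℚ_[2]) *
              ((ϖA * eulerDepleteTableList A l (ratPlusSymbol fA) ((a : ℚ) / (2 : ℚ) ^ (n + 2)) : ℚ) : ℚ_[2])‖ ≤ 1 := by
  intro W _ _ A _ _ hcm hr hss ha hAcm hAss hAa he _ f hf ϖ hϖ _ fA hfA ϖA hϖA l hl hl2 hlW hlA
  obtain ⟨u, n₀, hu⟩ := hEv W A hcm hr hss ha hAcm hAss hAa he f hf ϖ hϖ fA hfA ϖA hϖA l hl hl2 hlW hlA
  refine ⟨u, ?_⟩
  -- downward induction: the law at layer `n + 2` gives it at layer `n`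
  have step : ∀ n : ℕ, (∀ a : ℕ, Odd a →
      ‖((ϖ * eulerDepleteTableList W l (ratPlusSymbol f) ((a : ℚ) / (2 : ℚ) ^ (n + 2 + 2)) : ℚ) : ℚ_[2]) -
          ((u : ℤ_[2]) : ℚ_[2]) *
            ((ϖA * eulerDepleteTableList A l (ratPlusSymbol fA) ((a : ℚ) / (2 : ℚ) ^ (n + 2 + 2)) : ℚ) : ℚ_[2])‖ ≤ 1) →
      ∀ a : ℕ, Odd a →
      ‖((ϖ * eulerDepleteTableList W l (ratPlusSymbol f) ((a : ℚ) / (2 : ℚ) ^ (n + 2)) : ℚ) : ℚ_[2]) -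
          ((u : ℤ_[2]) : ℚ_[2]) *
            ((ϖA * eulerDepleteTableList A l (ratPlusSymbol fA) ((a : ℚ) / (2 : ℚ) ^ (n + 2)) : ℚ) : ℚ_[2])‖ ≤ 1 := by
    intro n hn2 a hodd
    have hodd' : Odd (a + 2 ^ (n + 2 + 1)) := hodd.add_even (Nat.even_pow.mpr ⟨even_two, by omega⟩)
    have h1 := hn2 a hodd
    have h2 := hn2 (a + 2 ^ (n + 2 + 1)) hodd'
    rw [eulerDepleteTableList_descent W hss ha hf l hl2 a (n + 2), eulerDepleteTableList_descent A hAss hAa hfA l hl2 a (n + 2)]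
    have e : ((ϖ * (-eulerDepleteTableList W l (ratPlusSymbol f) ((a : ℚ) / (2 : ℚ) ^ (n + 2 + 2)) -
          eulerDepleteTableList W l (ratPlusSymbol f) (((a + 2 ^ (n + 2 + 1) : ℕ) : ℚ) / (2 : ℚ) ^ (n + 2 + 2))) : ℚ) :
          ℚ_[2]) -
        ((u : ℤ_[2]) : ℚ_[2]) * ((ϖA * (-eulerDepleteTableList A l (ratPlusSymbol fA) ((a : ℚ) / (2 : ℚ) ^ (n + 2 + 2)) -
          eulerDepleteTableList A l (ratPlusSymbol fA) (((a + 2 ^ (n + 2 + 1) : ℕ) : ℚ) / (2 : ℚ) ^ (n + 2 + 2))) : ℚ) :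
          ℚ_[2]) =
      -(((ϖ * eulerDepleteTableList W l (ratPlusSymbol f) ((a : ℚ) / (2 : ℚ) ^ (n + 2 + 2)) : ℚ) : ℚ_[2]) -
          ((u : ℤ_[2]) : ℚ_[2]) *
            ((ϖA * eulerDepleteTableList A l (ratPlusSymbol fA) ((a : ℚ) / (2 : ℚ) ^ (n + 2 + 2)) : ℚ) : ℚ_[2])) +
        -(((ϖ * eulerDepleteTableList W l (ratPlusSymbol f) (((a + 2 ^ (n + 2 + 1) : ℕ) : ℚ) / (2 : ℚ) ^ (n + 2 + 2)) :
            ℚ) : ℚ_[2]) -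
          ((u : ℤ_[2]) : ℚ_[2]) *
            ((ϖA * eulerDepleteTableList A l (ratPlusSymbol fA) (((a + 2 ^ (n + 2 + 1) : ℕ) : ℚ) / (2 : ℚ) ^ (n + 2 + 2)) :
              ℚ) : ℚ_[2])) := by
      push_cast; ring
    rw [e]
    refine (IsUltrametricDist.norm_add_le_max _ _).trans (max_le ?_ ?_)
    · rw [norm_neg]; exact h1
    · rw [norm_neg]; exact h2
  -- induction on the distance to `n₀`
  have main : ∀ d n : ℕ, n₀ ≤ n + 2 * d → Even n → ∀ a : ℕ, Odd a →
      ‖((ϖ * eulerDepleteTableList W l (ratPlusSymbol f) ((a : ℚ) / (2 : ℚ) ^ (n + 2)) : ℚ) : ℚ_[2]) -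
          ((u : ℤ_[2]) : ℚ_[2]) *
            ((ϖA * eulerDepleteTableList A l (ratPlusSymbol fA) ((a : ℚ) / (2 : ℚ) ^ (n + 2)) : ℚ) : ℚ_[2])‖ ≤ 1 := by
    intro d
    induction d with
    | zero => intro n hn hev; exact hu n (by omega) hev
    | succ d ih =>
      intro n hn hev
      exact step n (ih (n + 2) (by omega) (hev.add (by decide)))
  intro n hev a hodd
  exact main n₀ n (by omega) hev a hodd

/-- **The crux from the EVENTUAL depleted-symbol law (SP2-ev).** [cite: GreenbergVatsal2000, §1 (8) and §3 (13)]
[cite: Vatsal1999, (1.6) and Thm. (1.13)] -/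
theorem mazurTateCongruenceAtTwoTop_of_eventuallyDepletedSymbolLaw
    (hEv : ∀ (W : WeierstrassCurve ℚ) [W.IsElliptic] [W.IsGloballyMinimal] (A : WeierstrassCurve ℚ) [A.IsElliptic]
      [A.IsGloballyMinimal], ¬ W.HasCM → W.analyticRank = 0 → GoodSS W 2 → W.frobeniusTrace 2 = 0 → A.HasCM →
      GoodSS A 2 → A.frobeniusTrace 2 = 0 →
      (∃ e : WeierstrassCurve.geomTorsion W (2 : ℤ) ≃+ WeierstrassCurve.geomTorsion A (2 : ℤ),
        ∀ (σ : Field.absoluteGaloisGroup ℚ) (P : WeierstrassCurve.geomTorsion W (2 : ℤ)), e (σ • P) = σ • e P) →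
      ∀ [NeZero (W.conductorNorm ℤ)] (f : CuspForm (Gamma0 (W.conductorNorm ℤ)) 2), IsNewformOf W f →
      ∀ (ϖ : ℚ), (ϖ : ℝ) * W.realPeriodRat = plusPeriod f →
      ∀ [NeZero (A.conductorNorm ℤ)] (fA : CuspForm (Gamma0 (A.conductorNorm ℤ)) 2), IsNewformOf A fA →
      ∀ (ϖA : ℚ), (ϖA : ℝ) * A.realPeriodRat = plusPeriod fA →
      ∀ (l : List (HeightOneSpectrum (𝓞 ℚ))), l.Nodup → (∀ v ∈ l, ((2 : ℕ) : 𝓞 ℚ) ∉ v.asIdeal) →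
        (∀ v : HeightOneSpectrum (𝓞 ℚ), ¬ W.HasGoodReductionAt v → v ∈ l) →
        (∀ v : HeightOneSpectrum (𝓞 ℚ), ¬ A.HasGoodReductionAt v → v ∈ l) →
      ∃ (u : ℤ_[2]ˣ) (n₀ : ℕ), ∀ n : ℕ, n₀ ≤ n → Even n → ∀ a : ℕ, Odd a →
        ‖((ϖ * eulerDepleteTableList W l (ratPlusSymbol f) ((a : ℚ) / (2 : ℚ) ^ (n + 2)) : ℚ) : ℚ_[2]) -
            ((u : ℤ_[2]) : ℚ_[2]) *
              ((ϖA * eulerDepleteTableList A l (ratPlusSymbol fA) ((a : ℚ) / (2 : ℚ) ^ (n + 2)) : ℚ) : ℚ_[2])‖ ≤ 1) :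
    Summit.BirchSwinnertonDyer.BirchSwinnertonDyer.Theses.ThetaPartnerAtTwo.MazurTateCongruenceAtTwoTop :=
  mazurTateCongruenceAtTwoTop_of_depletedSymbolLaw (depletedSymbolLaw_of_eventually hEv)

end Descent

end Summit.BirchSwinnertonDyer.BirchSwinnertonDyer.Theorems.MazurTateCongruenceAtTwoR

end
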